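import Literature.AlgebraicGeometry.Resolution.PointBlowupFlagDropCompanion
import Literature.AlgebraicGeometry.Resolution.PlaneGermBlowupCalculus
import HarnessLib

/-!
# Hauser–Perlega, Proposition 4 case (i) on the atlas: the bookkeeping of the monomial step `step q x 0 s` and the
# typed drop `s_𝓖 + d_res! = s_𝓕`; the charts of the surface games

H. Hauser, S. Perlega, *Resolving surface singularities in positive characteristic*, Publ. RIMS Kyoto Univ. **60**
(2024) 767–813 [cite: HauserPerlega2024], §2 p. 774 / §4 p. 779 (the localized point blow-up at `t = 0`:
"`E′_{a′} = V(xy)` if `t = 0` and `V(y) ⊆ E_a`, `V(x)` if `t ≠ 0` or `V(y) ⊄ E_a`"; "If `t = 0`, the expansion of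
`F′(x,y)` is again clean. It is immediate to see that `d′_res ≤ d_res` holds in this case") and Prop. 4 proof case (i)
(p. 794 l. 22 – p. 795 l. 5).

## What is proved (sorry-free; NO new definition, NO named fact)

* Section A — THE CHARTS OF THE GAMES (`Fin 2`): the monomial substitution of `PointBlowupFlagDropMonomialStep` is
  `PlaneGerm.dirChart 0 = (x, xy)` and the triangular shift by `t·x` is the shear of `PlaneGermBlowupCalculus`, so
  `b(x, x(t + y))` = shift by `t·x` followed by `(x, xy)` (`step_eq_dirChart_zero`, `shift_eq_shearX`,
  `subst_dirChart_eq_step_shift`) — the successor conventions of the surface games (`X 0 ^ q · T = subst (dirChart t) A`)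
  are the hypotheses `x^q·T = S(x,xy)` of the series-level files.
* Section B — TYPED BOOKKEEPING of `step q x 0 s` (two letters, `s.F ≠ 0` clean, `q < ord s.F`, `E = excLetters s ⊆ {x}`):
  `excLetters (step q x 0 s) = insert x (excLetters s)` (`excLetters_step_zero`); the exceptional exponent of the
  successor is `x^{r′}`, `r′ = ord F − q` (`bigH_step_zero`, `ordVar_step_zero`, `excExponent_step_zero`); every
  monomial of `F′` has degree `≥ ord F′ = r′ + d′_res`.
* Section C — **[HP24, Prop. 4 case (i)] TYPED**: `dRes E′ F′ ≤ dRes E F` (`dRes_step_le`); if equality holds and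
  `d_res ≥ pᵉ`, then for every case-(i) flag `⟨y, x, h⟩` at `a′`, **`sValue q E′ ⟨y,x,h⟩ F′ + d_res! =
  sValue q E ⟨y,x,X·h⟩ F`** (`sValue_step_add_factorial`), hence, off the terminal cases at `a`, `sValue q E′ ⟨y,x,h⟩ F′`
  is STRICTLY below the maximal `s` at `a` (`sValue_step_lt_max`) — "This proves that `s_𝓖 < s_𝓕`".

## What is NOT proved here

The companion branch `0 < d_res < pᵉ` on the atlas; `t ≠ 0` (cases (ii), (iv)); the assembly of `FlagInvariantDropsStatement`.

Provenance: seat res-D-pv-058 acting as res-L1-w43-stub-6 (cell res-hironaka, chain W4.3), 2026-08-27; a Literature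
transcription of a PRINTED, refereed proposition in the tree's polynomial/power-series model — not a statement about
any manuscript under adjudication.
-/

noncomputable section

open MvPolynomial Finset
open scoped BigOperators

namespace Literature.AlgebraicGeometry.Resolution

open Literature.AlgebraicGeometry.Resolution.Hauser2010
open Literature.AlgebraicGeometry.Resolution.PointBlowup
open Literature.AlgebraicGeometry.Resolution.HauserWagner2014

namespace HauserPerlega2024

/-! ## A. The charts of the surface games (`Fin 2`) -/

section Charts

variable {K : Type*} [Field K]

/-- **`(x, xy)` is `dirChart 0`**: the monomial substitution of the series files, on `Fin 2` with `x = X 0`, `y = X 1`,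
is the chart of slope `0` of `PlaneGermBlowup`. [cite: HauserPerlega2024, §2 p. 774 l. 6–8 (φ(x) = x, φ(y) = xy)] -/
theorem step_eq_dirChart_zero :
    (fun l : Fin 2 => if l = (1 : Fin 2) then (MvPowerSeries.X 0 : MvPowerSeries (Fin 2) K) * MvPowerSeries.X 1
      else MvPowerSeries.X l) = PlaneGerm.dirChart (0 : K) := by
  funext l
  fin_cases l <;> simp [PlaneGerm.dirChart]

/-- **the shift by `t·x` is the shear `(x, y + t x)`** of `PlaneGermBlowupCalculus`. [cite: HauserPerlega2024, Prop. 4 proof p. 793 l. 30–35 (y ↦ y + tx)] -/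
theorem shift_eq_shearX (t : K) :
    (fun l : Fin 2 => if l = (1 : Fin 2) then
        (MvPowerSeries.X 1 : MvPowerSeries (Fin 2) K) +
          PowerSeries.subst (MvPowerSeries.X 0 : MvPowerSeries (Fin 2) K) (PowerSeries.C t * PowerSeries.X)
      else MvPowerSeries.X l) =
      (![MvPowerSeries.X 0, MvPowerSeries.X 1 + MvPowerSeries.C t * MvPowerSeries.X 0] :
        Fin 2 → MvPowerSeries (Fin 2) K) := by
  have hψ : PowerSeries.subst (MvPowerSeries.X 0 : MvPowerSeries (Fin 2) K) (PowerSeries.C t * PowerSeries.X) =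
      MvPowerSeries.C t * MvPowerSeries.X 0 := by
    rw [PowerSeries.subst_mul (PowerSeries.HasSubst.X 0), PowerSeries.subst_C,
      PowerSeries.subst_X (PowerSeries.HasSubst.X 0)]
  funext l
  fin_cases l <;> simp [hψ]

/-- **`b(x, x(t + y))` is the shift by `t·x` followed by `(x, xy)`** — the successor convention
`X 0 ^ q · T = subst (dirChart t) A` of the surface games is the hypothesis `x^q·T = S(x,xy)` of the series files with
`S = A(x, y + t x)`. [cite: HauserPerlega2024, Prop. 4 proof p. 793 l. 28–35 (φ(y) = x(y + t))] -/
theorem subst_dirChart_eq_step_shift (t : K) (H : MvPowerSeries (Fin 2) K) :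
    MvPowerSeries.subst (PlaneGerm.dirChart t) H =
      MvPowerSeries.subst (fun l : Fin 2 => if l = (1 : Fin 2) then
          (MvPowerSeries.X 0 : MvPowerSeries (Fin 2) K) * MvPowerSeries.X 1 else MvPowerSeries.X l)
        (MvPowerSeries.subst (fun l : Fin 2 => if l = (1 : Fin 2) then
          (MvPowerSeries.X 1 : MvPowerSeries (Fin 2) K) +
            PowerSeries.subst (MvPowerSeries.X 0 : MvPowerSeries (Fin 2) K) (PowerSeries.C t * PowerSeries.X)
          else MvPowerSeries.X l) H) := by
  rw [PlaneGerm.subst_dirChart, shift_eq_shearX]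
  congr 1
  funext l
  fin_cases l <;> simp

end Charts

/-! ## B. Typed bookkeeping of the monomial step `step q x 0 s` -/

section Bookkeeping

variable {σ : Type*} [Fintype σ] [DecidableEq σ] {K : Type*} [Field K] [DecidableEq K]

omit [Fintype σ] [DecidableEq σ] [DecidableEq K] in
/-- the exponent `x^a y^b` evaluated at `x`. [folklore] -/
private theorem s_l {x y : σ} (hxy : x ≠ y) (a b : ℕ) : (Finsupp.single x a + Finsupp.single y b) x = a := by
  classical
  rw [Finsupp.add_apply, Finsupp.single_eq_same, Finsupp.single_apply, if_neg (Ne.symm hxy), add_zero]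

omit [Fintype σ] [DecidableEq σ] [DecidableEq K] in
/-- the exponent `x^a y^b` evaluated at `y`. [folklore] -/
private theorem s_r {x y : σ} (hxy : x ≠ y) (a b : ℕ) : (Finsupp.single x a + Finsupp.single y b) y = b := by
  classical
  rw [Finsupp.add_apply, Finsupp.single_eq_same, Finsupp.single_apply, if_neg hxy, zero_add]

omit [DecidableEq σ] [DecidableEq K] in
/-- two letters: a sum over all letters has two terms. [folklore] -/
private theorem s2 {M : Type*} [AddCommMonoid M] {x y : σ} (hxy : x ≠ y) (hσ : ∀ l, l = x ∨ l = y) (f : σ → M) :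
    ∑ l, f l = f x + f y := by
  classical
  have huniv : (Finset.univ : Finset σ) = {x, y} := by
    ext l
    simp only [Finset.mem_univ, Finset.mem_insert, Finset.mem_singleton, true_iff]
    exact hσ l
  rw [huniv, Finset.sum_pair hxy]

omit [Fintype σ] in
/-- **"`E′_{a′} = V(xy)` if `t = 0` and `V(y) ⊆ E_a`, `V(x)` if … `V(y) ⊄ E_a`"**: at the origin of the `x`-chart the
exceptional letters of the successor are `x` together with the old ones (for `ord F > q`, so that the new component has
positive multiplicity). [cite: HauserPerlega2024, §4 p. 779 l. 9–12] -/
theorem excLetters_step_zero (q : ℕ) (x : σ) (s : State σ K) (hq : (q : ℕ∞) < ordZero s.F) (hF : s.F ≠ 0) :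
    excLetters (step q x 0 s) = insert x (excLetters s) := by
  classical
  have hne : ordZero s.F ≠ ⊤ := by
    unfold ordZero; rw [Ne, MvPowerSeries.order_eq_top_iff, MvPolynomial.coe_eq_zero_iff]; exact hF
  have hpos : (ordZero s.F).toNat - q ≠ 0 := by
    have h1 := ENat.coe_toNat hne
    rw [← h1] at hq
    have : q < (ordZero s.F).toNat := by exact_mod_cast hq
    omega
  have hfilter : (s.r.filter fun i => (0 : σ → K) i = 0) = s.r :=
    (Finsupp.filter_eq_self_iff _ _).mpr fun i _ => rfl
  have h1 : (step q x 0 s).r = s.r.update x ((ordZero s.F).toNat - q) := by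
    show newMult q x 0 s = _
    unfold newMult
    rw [hfilter]
  unfold excLetters
  rw [h1]
  convert Finsupp.support_update_ne_zero s.r x hpos using 1

omit [Fintype σ] [DecidableEq K] in
/-- a clean polynomial is its own cleaning as a series. [cite: HauserPerlega2024, §2 p. 774 (clean expansion)] -/
theorem cleanSeries_coe_of_clean (q : ℕ) (F : MvPolynomial σ K) (hclean : deletePthPowers q F = F) :
    cleanSeries q (F : MvPowerSeries σ K) = (F : MvPowerSeries σ K) := by
  rw [← coe_deletePthPowers, hclean]

omit [Fintype σ] [DecidableEq σ] [DecidableEq K] in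
/-- every monomial of a non-zero polynomial has degree at least its order. [folklore] -/
private theorem ordZero_le_degree (F : MvPolynomial σ K) (d : σ →₀ ℕ) (hd : d ∈ F.support) :
    ordZero F ≤ (d.degree : ℕ∞) := by
  unfold ordZero
  exact MvPowerSeries.order_le (by rw [MvPolynomial.coeff_coe]; exact MvPolynomial.mem_support_iff.mp hd)

omit [Fintype σ] [DecidableEq σ] [DecidableEq K] in
/-- `q ≤ ord F` in `ℕ` for `F ≠ 0`. [folklore] -/
private theorem le_toNat_ordZero {q : ℕ} {F : MvPolynomial σ K} (hF : F ≠ 0) (hq : (q : ℕ∞) ≤ ordZero F) :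
    q ≤ (ordZero F).toNat := by
  have hne : ordZero F ≠ ⊤ := by
    unfold ordZero; rw [Ne, MvPowerSeries.order_eq_top_iff, MvPolynomial.coe_eq_zero_iff]; exact hF
  rw [← ENat.coe_toNat hne] at hq
  exact_mod_cast hq

/-- **the atlas step at `t = 0` as the series identity `x^q·↑F′ = ↑F(x, xy)`** for a clean `F` with `ord F ≥ q`.
[cite: HauserPerlega2024, §2 p. 774 l. 4–20] -/
theorem X_pow_mul_coe_step_zero_of_clean (q : ℕ) (x y : σ) (hxy : x ≠ y) (hσ : ∀ l, l = x ∨ l = y)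
    (s : State σ K) (hclean : deletePthPowers q s.F = s.F) (hq : (q : ℕ∞) ≤ ordZero s.F) :
    (MvPowerSeries.X x : MvPowerSeries σ K) ^ q * ((step q x 0 s).F : MvPowerSeries σ K) =
      MvPowerSeries.subst (fun l => if l = y then (MvPowerSeries.X x : MvPowerSeries σ K) * MvPowerSeries.X y
        else MvPowerSeries.X l) (s.F : MvPowerSeries σ K) := by
  have hF : ∀ d ∈ s.F.support, q ≤ d.degree := fun d hd => by
    have := le_trans hq (ordZero_le_degree s.F d hd)
    exact_mod_cast this
  rw [X_pow_mul_coe_step_zero q x y hxy hσ s hF, cleanSeries_coe_of_clean q s.F hclean]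

/-- **the exceptional exponent of the successor**: for `F ≠ 0` clean with `ord F ≥ q`, the least `x`-exponent of
`F′ = (step q x 0 s).F` is `ord F − q` (`≥`: every monomial of `F′` comes from a monomial of `F` of degree `= x`-exponent
`+ q`; `≤`: the image of a clean monomial of degree `ord F` survives) — "`M′(x,y) = x^{d_res−pᵉ}M(x,xy)`".
[cite: HauserPerlega2024, Prop. 4 proof case (i) p. 794 l. 36–38] -/
theorem bigH_step_zero (q : ℕ) (x y : σ) (hxy : x ≠ y) (hσ : ∀ l, l = x ∨ l = y) (s : State σ K)
    (hF : s.F ≠ 0) (hclean : deletePthPowers q s.F = s.F) (hq : (q : ℕ∞) ≤ ordZero s.F) :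
    bigH (step q x 0 s).F x = (((ordZero s.F).toNat - q : ℕ) : ℕ∞) := by
  classical
  have hstep := X_pow_mul_coe_step_zero_of_clean q x y hxy hσ s hclean hq
  have hne : ordZero s.F ≠ ⊤ := by
    unfold ordZero; rw [Ne, MvPowerSeries.order_eq_top_iff, MvPolynomial.coe_eq_zero_iff]; exact hF
  obtain ⟨o, ho'⟩ := WithTop.ne_top_iff_exists.mp hne
  have ho : ordZero s.F = o := ho'.symm
  have hoq : q ≤ o := by rw [ho] at hq; exact_mod_cast hq
  have htoNat : (ordZero s.F).toNat = o := by rw [ho]; rfl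
  rw [htoNat]
  unfold bigH
  apply le_antisymm
  · -- the image of a clean monomial of degree `o`
    obtain ⟨⟨m₀, hm₀, hdeg₀⟩, -⟩ := (ordZero_eq_nat_iff s.F o).mp ho
    rw [Finsupp.degree_eq_sum, s2 hxy hσ] at hdeg₀
    set n₀ : σ →₀ ℕ := Finsupp.single x (o - q) + Finsupp.single y (m₀ y) with hn₀
    have hcoef : MvPowerSeries.coeff n₀ ((step q x 0 s).F : MvPowerSeries σ K) = MvPolynomial.coeff m₀ s.F := by
      rw [coeff_eq_of_step q x y hxy hσ _ _ hstep n₀, hn₀, s_l hxy, s_r hxy, if_pos (by omega), MvPolynomial.coeff_coe]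
      congr 1
      ext l
      rcases hσ l with rfl | rfl
      · rw [s_l hxy]; omega
      · rw [s_r hxy]
    have hmem : n₀ ∈ (step q x 0 s).F.support := by
      rw [MvPolynomial.mem_support_iff, ← MvPolynomial.coeff_coe, hcoef]; exact hm₀
    calc (step q x 0 s).F.support.inf (fun d => ((d x : ℕ) : ℕ∞)) ≤ ((n₀ x : ℕ) : ℕ∞) := Finset.inf_le hmem
      _ = ((o - q : ℕ) : ℕ∞) := by rw [hn₀, s_l hxy]
  · refine Finset.le_inf fun d hd => ?_
    have hc : MvPowerSeries.coeff d ((step q x 0 s).F : MvPowerSeries σ K) ≠ 0 := by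
      rw [MvPolynomial.coeff_coe]; exact MvPolynomial.mem_support_iff.mp hd
    rw [coeff_eq_of_step q x y hxy hσ _ _ hstep d] at hc
    by_cases hle : d y ≤ d x + q
    · rw [if_pos hle, MvPolynomial.coeff_coe] at hc
      have h1 := ordZero_le_degree s.F _ (MvPolynomial.mem_support_iff.mpr hc)
      rw [ho, Finsupp.degree_eq_sum, s2 hxy hσ, s_l hxy, s_r hxy] at h1
      have h2 : o ≤ d x + q - d y + d y := by exact_mod_cast h1
      exact_mod_cast (show o - q ≤ d x by omega)
    · rw [if_neg hle] at hc
      exact absurd rfl hc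

/-- `ord_x F′ = ord F − q` as a natural number. [cite: HauserPerlega2024, Prop. 4 proof case (i) p. 794 l. 36–38] -/
theorem ordVar_step_zero (q : ℕ) (x y : σ) (hxy : x ≠ y) (hσ : ∀ l, l = x ∨ l = y) (s : State σ K)
    (hF : s.F ≠ 0) (hclean : deletePthPowers q s.F = s.F) (hq : (q : ℕ∞) ≤ ordZero s.F) :
    ordVar (step q x 0 s).F x = (ordZero s.F).toNat - q := by
  unfold ordVar
  rw [bigH_step_zero q x y hxy hσ s hF hclean hq]
  rfl

omit [DecidableEq σ] [DecidableEq K] in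
/-- **every monomial of the successor sits above its order, which is `ord_x F′ + d′_res`** (`E′ = {x}`):
`ord_x F′ + dRes {x} F′ ≤ m_x + m_y` for `m ∈ supp F′`. [cite: HauserPerlega2024, §4 p. 776 (d_res = ord F − ord_{E_a} F)] -/
theorem ordVar_add_dRes_le_of_mem_support (x y : σ) (hxy : x ≠ y) (hσ : ∀ l, l = x ∨ l = y) (G : MvPolynomial σ K)
    (m : σ →₀ ℕ) (hm : m ∈ G.support) : ordVar G x + dRes {x} G ≤ m x + m y := by
  classical
  have hG : G ≠ 0 := fun h0 => by rw [h0, MvPolynomial.support_zero] at hm; exact absurd hm (Finset.notMem_empty m)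
  have hne : ordZero G ≠ ⊤ := by
    unfold ordZero; rw [Ne, MvPowerSeries.order_eq_top_iff, MvPolynomial.coe_eq_zero_iff]; exact hG
  obtain ⟨o, ho'⟩ := WithTop.ne_top_iff_exists.mp hne
  have ho : ordZero G = o := ho'.symm
  have htoNat : (ordZero G).toNat = o := by rw [ho]; rfl
  -- `ord_x G ≤ o`
  obtain ⟨⟨m₁, hm₁, hdeg₁⟩, -⟩ := (ordZero_eq_nat_iff G o).mp ho
  rw [Finsupp.degree_eq_sum, s2 hxy hσ] at hdeg₁
  have hr : ordVar G x ≤ m₁ x := by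
    unfold ordVar bigH
    exact ENat.toNat_le_of_le_coe (Finset.inf_le (MvPolynomial.mem_support_iff.mpr hm₁))
  have h1 := ordZero_le_degree G m hm
  rw [ho, Finsupp.degree_eq_sum, s2 hxy hσ] at h1
  have h2 : o ≤ m x + m y := by exact_mod_cast h1
  unfold dRes
  rw [Finset.sum_singleton, htoNat]
  omega

omit [Fintype σ] [DecidableEq σ] [DecidableEq K] in
/-- the exceptional exponent for `E = {x}` is `x^{ord_x}`. [cite: HauserPerlega2024, §4 p. 776 (the monomial M)] -/
theorem excExponent_singleton (x : σ) (G : MvPolynomial σ K) : excExponent {x} G = Finsupp.single x (ordVar G x) := by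
  unfold excExponent; rw [Finset.sum_singleton]

end Bookkeeping

/-! ## C. Typed case (i): `d′_res ≤ d_res` and `s_𝓖 + d_res! = s_𝓕` along `step q x 0 s` -/

section TypedCaseOne

variable {σ : Type*} [Fintype σ] [DecidableEq σ] {K : Type*} [Field K] [DecidableEq K]

omit [DecidableEq K] in
/-- the order of a clean non-zero `F` is `r + d_res` for the exceptional exponent `x^r` (from the series-level
hypotheses of `exists_excExponent_eq_single`). [cite: HauserPerlega2024, §4 p. 776 (d_res = ord F − ord_{E_a} F)] -/
private theorem ordZero_toNat_eq (q : ℕ) (x y : σ) (hxy : x ≠ y) (hσ : ∀ l, l = x ∨ l = y) {F : MvPolynomial σ K}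
    (hF : F ≠ 0) (hclean : deletePthPowers q F = F) {r d : ℕ}
    (hminH : ∀ m, MvPowerSeries.coeff m (F : MvPowerSeries σ K) ≠ 0 → r + d ≤ m x + m y)
    (hexH : ∃ m, MvPowerSeries.coeff m (cleanSeries q (F : MvPowerSeries σ K)) ≠ 0 ∧ m x + m y = r + d) :
    (ordZero F).toNat = r + d := by
  classical
  have hne : ordZero F ≠ ⊤ := by
    unfold ordZero; rw [Ne, MvPowerSeries.order_eq_top_iff, MvPolynomial.coe_eq_zero_iff]; exact hF
  obtain ⟨o, ho'⟩ := WithTop.ne_top_iff_exists.mp hne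
  have ho : ordZero F = o := ho'.symm
  have htoNat : (ordZero F).toNat = o := by rw [ho]; rfl
  rw [htoNat]
  apply le_antisymm
  · obtain ⟨m, hm, hdeg⟩ := hexH
    rw [cleanSeries_coe_of_clean q F hclean, MvPolynomial.coeff_coe] at hm
    have h1 := ordZero_le_degree F m (MvPolynomial.mem_support_iff.mpr hm)
    rw [ho, Finsupp.degree_eq_sum, s2 hxy hσ] at h1
    have h2 : o ≤ m x + m y := by exact_mod_cast h1
    omega
  · obtain ⟨⟨m₀, hm₀, hdeg₀⟩, -⟩ := (ordZero_eq_nat_iff F o).mp ho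
    have h1 := hminH m₀ (by rw [MvPolynomial.coeff_coe]; exact hm₀)
    rw [Finsupp.degree_eq_sum, s2 hxy hσ] at hdeg₀
    omega

/-- **"It is immediate to see that `d′_res ≤ d_res` holds in this case"** (typed, `t = 0`, chart of `x`, `E_a ⊆ V(x)`):
along `step q x 0 s` with `E = excLetters s ∈ {∅, {x}}`, `F ≠ 0` clean, `q < ord F`, the residual order of the successor
(for `E′ = {x}`) does not exceed `d_res`. [cite: HauserPerlega2024, §4 p. 779 l. 13–14; Prop. 4 proof case (i) p. 794 l. 30–33] -/
theorem dRes_step_le (p : ℕ) [Fact p.Prime] [CharP K p] {e : ℕ} (x y : σ) (hxy : x ≠ y) (hσ : ∀ l, l = x ∨ l = y)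
    (s : State σ K) {E : Finset σ} (hE : E = ∅ ∨ E = {x}) (hF : s.F ≠ 0)
    (hclean : deletePthPowers (p ^ e) s.F = s.F) (hq : ((p ^ e : ℕ) : ℕ∞) ≤ ordZero s.F) :
    dRes {x} (step (p ^ e) x 0 s).F ≤ dRes E s.F := by
  classical
  obtain ⟨r, hr, hxrH, hminH, hexH⟩ := exists_excExponent_eq_single p e x y hxy hσ hE hF hclean
  have hstep := X_pow_mul_coe_step_zero_of_clean (p ^ e) x y hxy hσ s hclean hq
  have ho := ordZero_toNat_eq (p ^ e) x y hxy hσ hF hclean hminH hexH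
  have hr' : ordVar (step (p ^ e) x 0 s).F x + p ^ e = r + dRes E s.F := by
    have h1 := le_toNat_ordZero hF hq
    rw [ordVar_step_zero (p ^ e) x y hxy hσ s hF hclean hq, ho] at *
    omega
  refine residual_le_of_step p x y hxy hσ (s.F : MvPowerSeries σ K) ((step (p ^ e) x 0 s).F : MvPowerSeries σ K)
    hstep r (ordVar (step (p ^ e) x 0 s).F x) (dRes E s.F) (dRes {x} (step (p ^ e) x 0 s).F) hr' hxrH hminH hexH
    fun m hm => ?_
  rw [MvPolynomial.coeff_coe] at hm
  exact ordVar_add_dRes_le_of_mem_support x y hxy hσ _ m (MvPolynomial.mem_support_iff.mpr hm)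

/-- **[HP24, Prop. 4 case (i)] TYPED: `s_𝓖 + d_res! = s_𝓕`.**  Along `step q x 0 s` (`E ∈ {∅, {x}}`, `F ≠ 0` clean,
`q ≤ d_res`, `q ≤ ord F`), if `d′_res = d_res` then for every case-(i) flag `⟨y, x, h⟩` at `a′` (`h(0) = 0`):
`sValue q {x} ⟨y,x,h⟩ F′ + d_res! = sValue q E ⟨y,x,X·h⟩ F` — "`coeff_{d_𝓖}(G′) = x^{−d_res}·coeff_{d_𝓕}(G)`" along
the flag `y + h(x)` at `a′` and `y + xh(x)` at `a`. [cite: HauserPerlega2024, Prop. 4 proof case (i) p. 794 l. 22 – p. 795 l. 5] -/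
theorem sValue_step_add_factorial (p : ℕ) [Fact p.Prime] [CharP K p] {e : ℕ} (x y : σ) (hxy : x ≠ y)
    (hσ : ∀ l, l = x ∨ l = y) (s : State σ K) {E : Finset σ} (hE : E = ∅ ∨ E = {x}) (hF : s.F ≠ 0)
    (hclean : deletePthPowers (p ^ e) s.F = s.F) (hq : ((p ^ e : ℕ) : ℕ∞) ≤ ordZero s.F)
    (hqd : p ^ e ≤ dRes E s.F) (hd : dRes {x} (step (p ^ e) x 0 s).F = dRes E s.F) (h : PowerSeries K)
    (hh : PowerSeries.constantCoeff h = 0) :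
    sValue (p ^ e) {x} ⟨y, x, h⟩ (step (p ^ e) x 0 s).F + ((dRes E s.F).factorial : ℕ∞) =
      sValue (p ^ e) E ⟨y, x, PowerSeries.X * h⟩ s.F := by
  classical
  obtain ⟨r, hr, hxrH, hminH, hexH⟩ := exists_excExponent_eq_single p e x y hxy hσ hE hF hclean
  have hstep := X_pow_mul_coe_step_zero_of_clean (p ^ e) x y hxy hσ s hclean hq
  have ho := ordZero_toNat_eq (p ^ e) x y hxy hσ hF hclean hminH hexH
  set F' := (step (p ^ e) x 0 s).F with hF'
  set d := dRes E s.F with hddef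
  set r' := ordVar F' x with hr'def
  have hr'q : r' + p ^ e = r + d := by
    have h1 := le_toNat_ordZero hF hq
    rw [hr'def, hF', ordVar_step_zero (p ^ e) x y hxy hσ s hF hclean hq]
    rw [ho] at h1 ⊢
    omega
  have hr' : excExponent {x} F' = Finsupp.single x r' := excExponent_singleton x F'
  have hnegh : PowerSeries.constantCoeff (-h) = 0 := by rw [map_neg, hh, neg_zero]
  -- the two row families
  set R : ℕ → PowerSeries K := fun j => PowerSeries.mk fun a =>
    MvPowerSeries.coeff (Finsupp.single x a + Finsupp.single y j) (residualFlat (p ^ e) E ⟨y, x, PowerSeries.X * h⟩ s.F)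
    with hRdef
  set R' : ℕ → PowerSeries K := fun j => PowerSeries.mk fun a =>
    MvPowerSeries.coeff (Finsupp.single x a + Finsupp.single y j) (residualFlat (p ^ e) {x} ⟨y, x, h⟩ F') with hR'def
  have hR : ∀ j v, PowerSeries.coeff v (R j) = MvPowerSeries.coeff (Finsupp.single x (r + v) + Finsupp.single y j)
      (cleanSeries (p ^ e) (MvPowerSeries.subst (fun l => if l = y then
        (MvPowerSeries.X y : MvPowerSeries σ K) + PowerSeries.subst (MvPowerSeries.X x : MvPowerSeries σ K) (PowerSeries.X * (-h))
        else MvPowerSeries.X l) (s.F : MvPowerSeries σ K))) := by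
    intro j v
    rw [hRdef]
    dsimp only
    rw [coeff_row_residualFlat (p ^ e) x y hxy hσ E s.F hr (PowerSeries.X * h) j v, ← mul_neg]
  have hR' : ∀ j v, PowerSeries.coeff v (R' j) = MvPowerSeries.coeff (Finsupp.single x (r' + v) + Finsupp.single y j)
      (cleanSeries (p ^ e) (MvPowerSeries.subst (fun l => if l = y then
        (MvPowerSeries.X y : MvPowerSeries σ K) + PowerSeries.subst (MvPowerSeries.X x : MvPowerSeries σ K) (-h)
        else MvPowerSeries.X l) (F' : MvPowerSeries σ K))) := by
    intro j v
    rw [hR'def]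
    exact coeff_row_residualFlat (p ^ e) x y hxy hσ {x} F' hr' h j v
  have hmain := inf_rows_step_add_factorial (p ^ e) x y hxy hσ (s.F : MvPowerSeries σ K) (F' : MvPowerSeries σ K)
    hstep r r' d hr'q hminH (-h) hnegh R R' hR hR'
  rw [sValue_eq_inf_of_le (p ^ e) {x} ⟨y, x, h⟩ F' (by rw [hd]; exact hqd),
    sValue_eq_inf_of_le (p ^ e) E ⟨y, x, PowerSeries.X * h⟩ s.F hqd, hd, ← hddef]
  exact hmain

/-- **[HP24, Prop. 4 case (i)] TYPED: "This proves that `s_𝓖 < s_𝓕`."**  With the hypotheses of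
`sValue_step_add_factorial` and `a` NOT terminal: for the maximizing case-(i) flag `⟨y, x, h⋆⟩` at `a` (Proposition 3,
`exists_isGreatest_sValue`), EVERY case-(i) flag `⟨y, x, h⟩` at `a′` has `sValue q {x} ⟨y,x,h⟩ F′ < sValue q E ⟨y,x,h⋆⟩ F`
— so `(d_res, 0, s_𝓖) < (d_res, 0, s)` lexicographically. [cite: HauserPerlega2024, Prop. 4 proof case (i) p. 794 l. 22 – p. 795 l. 5] -/
theorem sValue_step_lt_max (p : ℕ) [Fact p.Prime] [CharP K p] {e : ℕ} (x y : σ) (hxy : x ≠ y)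
    (hσ : ∀ l, l = x ∨ l = y) (s : State σ K) {E : Finset σ} (hE : E = ∅ ∨ E = {x}) (hF : s.F ≠ 0)
    (hclean : deletePthPowers (p ^ e) s.F = s.F) (hq : ((p ^ e : ℕ) : ℕ∞) ≤ ordZero s.F)
    (hqd : p ^ e ≤ dRes E s.F) (hd : dRes {x} (step (p ^ e) x 0 s).F = dRes E s.F)
    (hnt : ¬ IsTerminalSub (p ^ e) E s.F) :
    ∃ hmax : PowerSeries K, PowerSeries.constantCoeff hmax = 0 ∧
      sValue (p ^ e) E ⟨y, x, hmax⟩ s.F < ⊤ ∧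
      (∀ h' : PowerSeries K, PowerSeries.constantCoeff h' = 0 →
        sValue (p ^ e) E ⟨y, x, h'⟩ s.F ≤ sValue (p ^ e) E ⟨y, x, hmax⟩ s.F) ∧
      ∀ h : PowerSeries K, PowerSeries.constantCoeff h = 0 →
        sValue (p ^ e) {x} ⟨y, x, h⟩ (step (p ^ e) x 0 s).F < sValue (p ^ e) E ⟨y, x, hmax⟩ s.F := by
  obtain ⟨hmax, hh, hlt, hge⟩ := exists_isGreatest_sValue p x y hxy hσ hE hF hclean hqd hnt
  refine ⟨hmax, hh, hlt, hge, fun h hh' => ?_⟩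
  have hXh : PowerSeries.constantCoeff (PowerSeries.X * h) = 0 := by
    rw [map_mul, PowerSeries.constantCoeff_X, zero_mul]
  have heq := sValue_step_add_factorial p x y hxy hσ s hE hF hclean hq hqd hd h hh'
  have hle := hge (PowerSeries.X * h) hXh
  -- `s′ + d! ≤ S < ⊤` forces `s′ < S`
  obtain ⟨S, hS⟩ := ENat.ne_top_iff_exists.mp (ne_top_of_lt hlt)
  rw [← hS] at hle ⊢
  rw [← heq] at hle
  set s' := sValue (p ^ e) {x} ⟨y, x, h⟩ (step (p ^ e) x 0 s).F with hs'
  have hne : s' ≠ ⊤ := by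
    intro htop; rw [htop, top_add] at hle; exact absurd hle (by simp)
  obtain ⟨n, hn⟩ := ENat.ne_top_iff_exists.mp hne
  rw [← hn] at hle ⊢
  have hfac : 1 ≤ (dRes E s.F).factorial := Nat.factorial_pos _
  have h1 : n + (dRes E s.F).factorial ≤ S := by exact_mod_cast hle
  exact_mod_cast (show n < S by omega)

end TypedCaseOne

end HauserPerlega2024

end Literature.AlgebraicGeometry.Resolution
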